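/-
Copyright (c) 2026 the pub-hodgecm-mathlib formalisation cell (harness21).  Prover seat hodgecm-mathlib-K2E3-p31 (g0), HCML Track B «K2-LIT»,
h413 = `stmt-HodgeConjecture-24833`, line `K2_E3_EllipticInputs`, unit U12 «Characters», PART «SC» (ED. 2) leaf (SC-an)₂
`sig_K2E3SupercuspidalTruncatedCharAnalyticTwo`, road «FC₂» ∕ (M5h₂) chain (LINE-LEAD K2E3-plan (g4) deal D149 BY NAME 2026-09-04T15:06:53Z, split off K2E1-p10 (g3)'s D144):
piece [M6′]₂ «EXPLICIT Bset», FILE B (CARRIER SIDE) — the `Fin 2` twin of ★ [M6′] FILE B `K2E3SupercuspidalTruncatedCharLimCancExplicit` (K2E5-p04 (g3)), HYPOTHESIS-FIRST over the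
[M6′]₂ FILE A head (`K2E3SupercuspidalTruncatedCharRadiusDatumTwo.exists_radius_and_datum`, K2E3-p36 (g0), in flight).  2026-09-04.
-/
import Summits.HodgeConjecture.HodgeConjecture.Theorems.K2E3SupercuspModelFrameAtPlaceTwo          -- ★ [M2a]₂ FILE A p861132 (this seat): `isCompact_center_of_eq_over` (compact centre of `U(σ_w, Φ₂)(L_w)`)
import Summits.HodgeConjecture.HodgeConjecture.Theorems.K2E3UnitarySingularLocusNullTwo           -- ★ p861160 (K2E1-p10 g3): `ae_isRegularElt_of_eq_over_two` (the singular set of `U(σ_w, Φ₂)(L_w)` is Haar-null)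
import Summits.HodgeConjecture.HodgeConjecture.Theorems.K2E3TruncatedCharTransport                  -- ★ [M5′] p856489 (GENERIC): `exists_compactExhaustion_preimage`, `setIntegral_preimage_coeff_conj_eq`,
                                                                                                  --   `truncated_eq_inter_and_tendsto_of_map`, `isCompact_centralizer_iff_of_continuousMulEquiv`, `isSmooth∕isSupercuspidal_comp_continuousMulEquiv_symm`
import Summits.HodgeConjecture.HodgeConjecture.Theorems.K2E3RightInvariantSetIntegralVanishing      -- ★ (f1) (GENERIC): `setIntegral_eq_setIntegral_inter_of_sdiff_eq_zero`, `tendsto_setIntegral_of_forall_sdiff_eq_zero`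
import Literature.NumberTheory.Automorphic.AdmissibleInvariantFormSchur                             -- ★ `IsSupercuspidal.hasCompactSupport_sesqForm_apply_apply`
import Literature.NumberTheory.Automorphic.SmoothRepresentationLocallyConstant                    -- ★ `Representation.IsSmooth.isLocallyConstant_apply` (continuity of the coefficient slice)
import HarnessLib

/-!
# h413 ∕ Track B «K2-LIT», line `K2_E3_EllipticInputs`, unit U12, PART «SC» leaf (SC-an)₂, road «FC₂» ∕ (M5h₂) chain — piece [M6′]₂ «EXPLICIT Bset»: THE SPLIT-REGULAR BALL OF
# [M6]₂ AS THE PULL-BACK OF THE HEIGHT BALL `Ω_M (5 m_C + 3 s + 1)` OF A CHOSEN DATUM `(t, d, λ, y₀)` ON `M = U(σ_w, Φ₂)(L_w)`, AND `hball` REDUCED TO A MODEL INEQUALITY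
# (Harish-Chandra 1970, Part VII §3 p. 71 eq. (1), (ii), p. 72; Theorem 20; Cor. of Theorem 18) — HYPOTHESIS-FIRST over the [M6′]₂ FILE A head

Cell `pub/hodgecm-mathlib`, crux H413 = `stmt-HodgeConjecture-24833`, route of record `HCCMUnconditional`; chair K2-lead (g2), L4 LINE-LEAD ∕ dealer K2E3-plan (g4), architect
K2E3-p25 (g3), (M5h₂) chain desk K2E3-p27 (g0), TOP payer K2E3-p23 (g7) (D148).  THEOREMS ONLY (no `def`, no `instance`, no `notation`, no named-fact hypothesis, no `sorry`); lane
`--supports stmt-HodgeConjecture-24833 --as helper`, count-neutral.  The `Fin 2` TWIN of ★ [M6′] FILE B `Theorems/K2E3SupercuspidalTruncatedCharLimCancExplicit.lean` (K2E5-p04 (g3)):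
carrier `G = (cmDatum L 2 H).Local v` (`H ∈ M₂(L)`), model `M = U(σ_w, Φ₂)(L_w)`, `Fin 3 ↦ Fin 2`, `glDiagonal 3 ↦ glDiagonal 2`, radius `5(2m_θ + 2λ) + 3(2m_g + 2λ) + 1` VERBATIM, same two
head names in the namespace `…Cruxes.H413.K2E3SupercuspidalTruncatedCharLimCancExplicitTwo`.

HYPOTHESIS-FIRST (one letter).  The template's only `N`-specific input is ★ [M6′] FILE A `K2E3SupercuspidalTruncatedCharRadiusDatum.exists_radius_and_datum` (the radius `R(m)`
chosen element by element on the model, with the shell vanishing at regular `m` and the EXPORTED datum at regular split `m`).  Its `Fin 2` twin `…RadiusDatumTwo` (K2E3-p36 (g0), D-deal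
of L4 EMIT #2) is in flight; both heads below therefore take ONE extra binder **`hRD`** = that head's CONCLUSION ∀-closed over `(μM : Measure M) [μM.IsHaarMeasure] (ρM : Representation ℂ M V)
(hsmM) (hscM) (hBinvM) {mθ} (hθ) (m : M)` at the fixed model data `(w, hw, J := (StdForm.antidiagonal 2).over L_w, ΩM, ϖ, B, u, u')` — template :100–:131 with `3 ↦ 2`, token for
token — and NOTHING else (the template's binders `hϖ hmem hinv hmul`, consumed only by that head, are dropped here: `Ω_M` and `ϖ` enter through `hRD` alone): the payer instantiates `hRD := fun μM _ ρM hsmM hscM hBinvM _ hθ m => K2E3SupercuspidalTruncatedCharRadiusDatumTwo.exists_radius_and_datum L w hw rfl μM ΩM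
hϖ hmem hinv hmul ρM hsmM hscM B hBinvM u u' hθ m` (with that file's own letters, if any) and both conclusions are then the template's, letter-free.  Every other input is ★ and
GENERIC: ★ [M5′] `K2E3TruncatedCharTransport` (exhaustion pull-back, transport identity, `ρ ∘ e⁻¹` smooth ∕ supercuspidal, centralisers along `e`), ★ (f1)
`K2E3RightInvariantSetIntegralVanishing`, ★ `K2E3UnitarySingularLocusNullTwo.ae_isRegularElt_of_eq_over_two` (K2E1-p10 (g3); replaces ★ [M2a] §5), ★ [M2a]₂ FILE A
`isCompact_center_of_eq_over`, ★ `IsSupercuspidal.hasCompactSupport_sesqForm_apply_apply`, Mathlib `CompactExhaustion`; the continuity of the coefficient slice `x ↦ B u′ (ρ_M(x m x⁻¹) u)`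
(★ [M1] Model `continuous_coeff_conj`, `Fin 3`-typed there) is the 2-line generic composition ★ `Representation.IsSmooth.isLocallyConstant_apply` ∘ continuity of `x ↦ x m x⁻¹`, inlined.

WHY (as the template).  ★ [M6]₂ will inhabit the `hlim`∕`hcanc` binders of the (SC-an)₂ consumers on `G = (cmDatum L 2 H).Local v` with an OPAQUE radius; the DOMINATION brick
`hball : ∫_{Bset g} ‖θ(x g x⁻¹)‖ ≤ W g` must be proved for THE SAME `Bset`, so the radius is pinned to the (SC-dom)₂ currency: along a field model `e : G ≃ₜ* M = U(σ_w, Φ₂)(L_w)` with height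
balls `Ω_M` (INPUT, with `hmem` `hinv` `hmul`) THIS FILE sets `R(g) := R_M(e g)` (the `hRD` radius), `Bset g := Ω (R g) = e⁻¹(Ω_M (R g))`, proves the shell vanishing ∕ `hcanc` ∕ `hlim` a.e.
(★ (f1), ★ [M5′] transport, singular `e g` a null set by ★ SingularLocusNull₂), EXPORTS the datum clause of `hRD` at every `g` with `e g` regular and `Z_G(g)` non-compact (ellipticity
transports along `e`), and REDUCES `hball`∕`hballE` for `W := W_M ∘ e` to model integrals by `∫_{e⁻¹ S} ‖θ(x g x⁻¹)‖ dμ = ∫_S ‖θ_M(x′ (e g) x′⁻¹)‖ d(e_* μ)` (★ [M5′]).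

HONEST LABEL.  HC_CM is proved only modulo the 7 printed citations (2 remaining named inputs: hLiu418 = `stmt-HodgeConjecture-24832`, h413 = `stmt-HodgeConjecture-24833`)
until rung 0 closes; count-neutral helper; [M6′]₂ FILE B is REL over EXACTLY {[M6′]₂ FILE A `RadiusDatumTwo.exists_radius_and_datum`} (binder `hRD`), and the MODEL inequalities
behind `hball`, `hballE`, `hW` at `N = 2` are not proved here; (SC-an)₂ stays OPEN until COLL₂ + NC₂ + the whole (M5h₂) chain are ★.

## References
* [HarishChandra1970] Harish-Chandra (notes by G. van Dijk), *Harmonic Analysis on Reductive p-adic Groups*, LNM 162 (1970), Part VII §2 Theorem 20 p. 70, Cor. of Thm 18 p. 69;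
  §3 p. 71 eq. (1), (ii), p. 72; Part I §3 Lemma 14 p. 9; Part V Lemma 42.
* [Rogawski1990] J. D. Rogawski, *Automorphic Representations of Unitary Groups in Three Variables*, Ann. of Math. Stud. 123 (1990), §3.1 p. 19, §3.6 pp. 28–31, §4.9 p. 54,
  §12.2 p. 173, §12.5 p. 182.
* [PlatonovRapinchuk1994] V. Platonov, A. Rapinchuk, *Algebraic Groups and Number Theory* (1994), §5.1.
* [Folland1995] G. B. Folland, *A Course in Abstract Harmonic Analysis* (1995), §2.4.
* [Casselman1995] W. Casselman, *Introduction to the theory of admissible representations of p-adic reductive groups* (1995 notes), Prop. 1.4.4.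
-/

set_option autoImplicit false
-- the mandated namespace repeats the single-problem summit's segment (`HodgeConjecture.HodgeConjecture`)
set_option linter.dupNamespace false

noncomputable section

open MeasureTheory Measure Set Filter Topology NumberField IsDedekindDomain
open scoped NNReal ENNReal Pointwise Matrix MatrixGroups WithZero
open ValuativeRel
open Literature.NumberTheory.Automorphic Literature.NumberTheory.Automorphic.UnitaryGroup Literature.NumberTheory.Rogawski1990
open Literature.NumberTheory.GaloisRepresentations

namespace Summit.HodgeConjecture.HodgeConjecture.Cruxes.H413.K2E3SupercuspidalTruncatedCharLimCancExplicitTwo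

/-! ## The carrier `G = (cmDatum L 2 H).Local v` along a field model `e : G ≃ₜ* M`: the explicit exhaustion, radius and ball; the datum exported; `hball` reduced -/

section Carrier

variable (L : Type) [Field L] [NumberField L] [IsCMField L] (H : Matrix (Fin 2) (Fin 2) L)

set_option maxHeartbeats 800000 in
-- the statement is long (six exported clauses on the CM ∕ one-place carriers); default budget runs out in its elaboration (same class as ★ [M2a] FILE B's 800000)
/-- **[M6′] MAIN — EXPLICIT EXHAUSTION AND RADIUS ALONG A FIELD MODEL.**  `G = (cmDatum L 2 H).Local v`, `w ∣ v` fixed by conjugation, `e : G ≃ₜ* M = U(σ_w, Φ₂)(L_w)` ANY isomorphism of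
topological groups (★ (f2) at an isotropic `H_w`), `Ω_M` the height balls of `M` (INPUT, with `hmem` `hinv` `hmul` of ★ p856390), `μ` Haar on `G`, `ρ` smooth SUPERCUSPIDAL with invariant `B`,
`θ = B u′ (ρ(·) u)`, `θ_M = θ ∘ e⁻¹`.  There are `Ω` (`Ω n = e⁻¹ Ω_M n`), a radius `R : G → ℕ` and a support height `m_θ` of `θ_M` such that: (c) for `μ`-a.e. `g`, `∀ n, Θₙ(g) = ∫_{Ω n ∩ Ω (R g)} θ(x g x⁻¹)`
and `Θₙ(g) → Θ_{R g}(g)` (GUARD-FREE); (d) for EVERY `g` with `e g` regular and `Z_G(g)` NOT compact, a DATUM `(t, d, y₀, λ, m_g)` on `M` — `t = diag d` regular, `λ` its MINIMAL depth, `m_g`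
the MINIMAL height of `e g`, `y₀ ∈ Ω_M (2m_g + 2λ)`, `e g = y₀ t y₀⁻¹` — with **`R g = 5(2m_θ + 2λ) + 3(2m_g + 2λ) + 1`**; (e) `e g` is regular for `μ`-a.e. `g`; (f) the transport identity
`∫_{e⁻¹ S} ‖θ(x g x⁻¹)‖ dμ = ∫_S ‖θ_M(x′ (e g) x′⁻¹)‖ d(e_* μ)`.  HYPOTHESIS-FIRST over ONE letter `hRD` = the [M6′]₂ FILE A head `RadiusDatumTwo.exists_radius_and_datum`'s
conclusion ∀-closed over `(μM) (ρM) … (m)` (applied at `e_* μ`, `ρ_M = ρ ∘ e⁻¹`, generalised in the proof); ★ SingularLocusNull₂ (e) pulled back, ★ (f1), ★ [M5′].  The `Fin 2` twin of ★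
[M6′] `K2E3SupercuspidalTruncatedCharLimCancExplicit.exists_explicit_exhaustion_radius`.
[cite: HarishChandra1970, Part VII §3 p. 71 eq. (1), (ii), p. 72; §2 Theorem 20 p. 70] [cite: Rogawski1990, §12.2 p. 173, §12.5 p. 182] [cite: PlatonovRapinchuk1994, §5.1] [cite: Folland1995, §2.4] -/
theorem exists_explicit_exhaustion_radius
    {v : HeightOneSpectrum (𝓞 ↥(maximalRealSubfield L))} (w : PlacesOver L v) (hw : IsCMField.complexConj L • w.1 = w.1)
    [MeasurableSpace ((UnitaryGroup.cmDatum L 2 H).Local v)] [BorelSpace ((UnitaryGroup.cmDatum L 2 H).Local v)]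
    (μ : Measure ((UnitaryGroup.cmDatum L 2 H).Local v)) [μ.IsHaarMeasure]
    [MeasurableSpace ↥(unitaryGroupOfForm (galAdicCompletionMap (L := L) (IsCMField.complexConj L) hw) ((StdForm.antidiagonal 2).over (w.1.adicCompletion L)))]
    [BorelSpace ↥(unitaryGroupOfForm (galAdicCompletionMap (L := L) (IsCMField.complexConj L) hw) ((StdForm.antidiagonal 2).over (w.1.adicCompletion L)))]
    (e : (UnitaryGroup.cmDatum L 2 H).Local v ≃ₜ*
      ↥(unitaryGroupOfForm (galAdicCompletionMap (L := L) (IsCMField.complexConj L) hw) ((StdForm.antidiagonal 2).over (w.1.adicCompletion L))))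
    (ΩM : CompactExhaustion ↥(unitaryGroupOfForm (galAdicCompletionMap (L := L) (IsCMField.complexConj L) hw) ((StdForm.antidiagonal 2).over (w.1.adicCompletion L))))
    {ϖ : w.1.adicCompletion L}
    {V : Type*} [AddCommGroup V] [Module ℂ V] (ρ : Representation ℂ ((UnitaryGroup.cmDatum L 2 H).Local v) V) (hsm : ρ.IsSmooth) (hsc : ρ.IsSupercuspidal)
    (B : V →ₗ⋆[ℂ] V →ₗ[ℂ] ℂ) (hBinv : ∀ (g : (UnitaryGroup.cmDatum L 2 H).Local v) (x y : V), B (ρ g x) (ρ g y) = B x y) (u u' : V)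
    (hRD : ∀ (μM : Measure ↥(unitaryGroupOfForm (galAdicCompletionMap (L := L) (IsCMField.complexConj L) hw) ((StdForm.antidiagonal 2).over (w.1.adicCompletion L))))
      [μM.IsHaarMeasure]
      (ρM : Representation ℂ ↥(unitaryGroupOfForm (galAdicCompletionMap (L := L) (IsCMField.complexConj L) hw) ((StdForm.antidiagonal 2).over (w.1.adicCompletion L))) V),
      ρM.IsSmooth → ρM.IsSupercuspidal →
      (∀ (m : ↥(unitaryGroupOfForm (galAdicCompletionMap (L := L) (IsCMField.complexConj L) hw) ((StdForm.antidiagonal 2).over (w.1.adicCompletion L)))) (x y : V),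
        B (ρM m x) (ρM m y) = B x y) →
      ∀ {mθ : ℕ}, (∀ g : ↥(unitaryGroupOfForm (galAdicCompletionMap (L := L) (IsCMField.complexConj L) hw) ((StdForm.antidiagonal 2).over (w.1.adicCompletion L))),
        B u' (ρM g u) ≠ 0 → g ∈ ΩM mθ) →
      ∀ m : ↥(unitaryGroupOfForm (galAdicCompletionMap (L := L) (IsCMField.complexConj L) hw) ((StdForm.antidiagonal 2).over (w.1.adicCompletion L))),
      ∃ R : ℕ,
        (IsRegularElt (m : GL (Fin 2) (w.1.adicCompletion L)) → ∀ n : ℕ, ∫ x in ΩM n \ ΩM R, B u' (ρM (x * m * x⁻¹) u) ∂μM = 0) ∧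
        (IsRegularElt (m : GL (Fin 2) (w.1.adicCompletion L)) →
          ¬ IsCompact ((Subgroup.centralizer ({m} :
              Set ↥(unitaryGroupOfForm (galAdicCompletionMap (L := L) (IsCMField.complexConj L) hw) ((StdForm.antidiagonal 2).over (w.1.adicCompletion L)))) :
            Subgroup ↥(unitaryGroupOfForm (galAdicCompletionMap (L := L) (IsCMField.complexConj L) hw) ((StdForm.antidiagonal 2).over (w.1.adicCompletion L)))) :
              Set ↥(unitaryGroupOfForm (galAdicCompletionMap (L := L) (IsCMField.complexConj L) hw) ((StdForm.antidiagonal 2).over (w.1.adicCompletion L)))) →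
          ∃ (t y₀ : ↥(unitaryGroupOfForm (galAdicCompletionMap (L := L) (IsCMField.complexConj L) hw) ((StdForm.antidiagonal 2).over (w.1.adicCompletion L))))
            (d : Fin 2 → (w.1.adicCompletion L)ˣ) (lam mg : ℕ),
            glDiagonal 2 (w.1.adicCompletion L) d = (t : GL (Fin 2) (w.1.adicCompletion L)) ∧ IsRegularElt (t : GL (Fin 2) (w.1.adicCompletion L)) ∧
            (∀ i k : Fin 2, i ≠ k → Valued.v (ϖ ^ lam) ≤ Valued.v ((d i : w.1.adicCompletion L) - d k)) ∧
            (∀ lam' : ℕ, (∀ i k : Fin 2, i ≠ k → Valued.v (ϖ ^ lam') ≤ Valued.v ((d i : w.1.adicCompletion L) - d k)) → lam ≤ lam') ∧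
            m ∈ ΩM mg ∧ (∀ m' : ℕ, m ∈ ΩM m' → mg ≤ m') ∧
            y₀ ∈ ΩM (2 * mg + 2 * lam) ∧ m = y₀ * t * y₀⁻¹ ∧
            R = 5 * (2 * mθ + 2 * lam) + 3 * (2 * mg + 2 * lam) + 1)) :
    ∃ (Ω : CompactExhaustion ((UnitaryGroup.cmDatum L 2 H).Local v)) (R : (UnitaryGroup.cmDatum L 2 H).Local v → ℕ) (mθ : ℕ),
      (∀ n : ℕ, (Ω n : Set ((UnitaryGroup.cmDatum L 2 H).Local v)) = e ⁻¹' (ΩM n)) ∧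
      (∀ m' : ↥(unitaryGroupOfForm (galAdicCompletionMap (L := L) (IsCMField.complexConj L) hw) ((StdForm.antidiagonal 2).over (w.1.adicCompletion L))),
        B u' (ρ (e.symm m') u) ≠ 0 → m' ∈ ΩM mθ) ∧
      (∀ᵐ g ∂μ, (∀ n : ℕ, ∫ x in Ω n, B u' (ρ (x * g * x⁻¹) u) ∂μ = ∫ x in Ω n ∩ Ω (R g), B u' (ρ (x * g * x⁻¹) u) ∂μ) ∧
        Tendsto (fun n : ℕ => ∫ x in Ω n, B u' (ρ (x * g * x⁻¹) u) ∂μ) atTop (𝓝 (∫ x in Ω (R g), B u' (ρ (x * g * x⁻¹) u) ∂μ))) ∧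
      (∀ g : (UnitaryGroup.cmDatum L 2 H).Local v, IsRegularElt ((e g : ↥(unitaryGroupOfForm (galAdicCompletionMap (L := L) (IsCMField.complexConj L) hw)
          ((StdForm.antidiagonal 2).over (w.1.adicCompletion L)))) : GL (Fin 2) (w.1.adicCompletion L)) →
        ¬ IsCompact ((Subgroup.centralizer ({g} : Set ((UnitaryGroup.cmDatum L 2 H).Local v))) : Set ((UnitaryGroup.cmDatum L 2 H).Local v)) →
        ∃ (t y₀ : ↥(unitaryGroupOfForm (galAdicCompletionMap (L := L) (IsCMField.complexConj L) hw) ((StdForm.antidiagonal 2).over (w.1.adicCompletion L))))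
          (d : Fin 2 → (w.1.adicCompletion L)ˣ) (lam mg : ℕ),
          glDiagonal 2 (w.1.adicCompletion L) d = (t : GL (Fin 2) (w.1.adicCompletion L)) ∧ IsRegularElt (t : GL (Fin 2) (w.1.adicCompletion L)) ∧
          (∀ i k : Fin 2, i ≠ k → Valued.v (ϖ ^ lam) ≤ Valued.v ((d i : w.1.adicCompletion L) - d k)) ∧
          (∀ lam' : ℕ, (∀ i k : Fin 2, i ≠ k → Valued.v (ϖ ^ lam') ≤ Valued.v ((d i : w.1.adicCompletion L) - d k)) → lam ≤ lam') ∧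
          e g ∈ ΩM mg ∧ (∀ m' : ℕ, e g ∈ ΩM m' → mg ≤ m') ∧
          y₀ ∈ ΩM (2 * mg + 2 * lam) ∧ e g = y₀ * t * y₀⁻¹ ∧
          R g = 5 * (2 * mθ + 2 * lam) + 3 * (2 * mg + 2 * lam) + 1) ∧
      (∀ᵐ g ∂μ, IsRegularElt ((e g : ↥(unitaryGroupOfForm (galAdicCompletionMap (L := L) (IsCMField.complexConj L) hw)
          ((StdForm.antidiagonal 2).over (w.1.adicCompletion L)))) : GL (Fin 2) (w.1.adicCompletion L))) ∧
      (∀ (g : (UnitaryGroup.cmDatum L 2 H).Local v)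
        (S : Set ↥(unitaryGroupOfForm (galAdicCompletionMap (L := L) (IsCMField.complexConj L) hw) ((StdForm.antidiagonal 2).over (w.1.adicCompletion L)))),
        ∫ x in e ⁻¹' S, ‖B u' (ρ (x * g * x⁻¹) u)‖ ∂μ = ∫ x' in S, ‖B u' (ρ (e.symm (x' * e g * x'⁻¹)) u)‖ ∂(μ.map e)) := by
  haveI : (μ.map e).IsHaarMeasure := ContinuousMulEquiv.isHaarMeasure_map μ e
  -- the pulled-back exhaustion (★ [M5′] §1)
  obtain ⟨Ω, hΩ⟩ := K2E3TruncatedCharTransport.exists_compactExhaustion_preimage e.toHomeomorph ΩM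
  -- a.e. `e g` is regular (★ [M2a] FILE A (e) at the Haar measure `e_* μ`, pulled back)
  have hregae : ∀ᵐ g ∂μ, IsRegularElt ((e g : ↥(unitaryGroupOfForm (galAdicCompletionMap (L := L) (IsCMField.complexConj L) hw)
      ((StdForm.antidiagonal 2).over (w.1.adicCompletion L)))) : GL (Fin 2) (w.1.adicCompletion L)) :=
    ae_of_ae_map e.continuous.measurable.aemeasurable (K2E3UnitarySingularLocusNullTwo.ae_isRegularElt_of_eq_over_two L w hw rfl (μ.map e))
  -- the transport identity (★ [M5′] §2)
  have htrans : ∀ (g : (UnitaryGroup.cmDatum L 2 H).Local v)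
      (S : Set ↥(unitaryGroupOfForm (galAdicCompletionMap (L := L) (IsCMField.complexConj L) hw) ((StdForm.antidiagonal 2).over (w.1.adicCompletion L)))),
      ∫ x in e ⁻¹' S, ‖B u' (ρ (x * g * x⁻¹) u)‖ ∂μ = ∫ x' in S, ‖B u' (ρ (e.symm (x' * e g * x'⁻¹)) u)‖ ∂(μ.map e) := fun g S => by
    have h := K2E3TruncatedCharTransport.setIntegral_preimage_coeff_conj_eq e μ
      (fun m' : ↥(unitaryGroupOfForm (galAdicCompletionMap (L := L) (IsCMField.complexConj L) hw) ((StdForm.antidiagonal 2).over (w.1.adicCompletion L))) =>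
        ‖B u' (ρ (e.symm m') u)‖) S g
    simp only [ContinuousMulEquiv.symm_apply_apply] at h
    exact h
  -- GENERALISATION over the transported datum `ρ_M` (instantiated at `ρ ∘ e⁻¹`, ★ [M5′] §3): support height, radius choice (§1), shapes, datum
  suffices key : ∀ ρM : Representation ℂ
      ↥(unitaryGroupOfForm (galAdicCompletionMap (L := L) (IsCMField.complexConj L) hw) ((StdForm.antidiagonal 2).over (w.1.adicCompletion L))) V,
      ρM.IsSmooth → ρM.IsSupercuspidal → (∀ m (x y : V), B (ρM m x) (ρM m y) = B x y) →
      (∀ m' : ↥(unitaryGroupOfForm (galAdicCompletionMap (L := L) (IsCMField.complexConj L) hw) ((StdForm.antidiagonal 2).over (w.1.adicCompletion L))),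
        ρM m' = ρ (e.symm m')) →
      ∃ (R : (UnitaryGroup.cmDatum L 2 H).Local v → ℕ) (mθ : ℕ),
        (∀ m' : ↥(unitaryGroupOfForm (galAdicCompletionMap (L := L) (IsCMField.complexConj L) hw) ((StdForm.antidiagonal 2).over (w.1.adicCompletion L))),
          B u' (ρ (e.symm m') u) ≠ 0 → m' ∈ ΩM mθ) ∧
        (∀ᵐ g ∂μ, (∀ n : ℕ, ∫ x in Ω n, B u' (ρ (x * g * x⁻¹) u) ∂μ = ∫ x in Ω n ∩ Ω (R g), B u' (ρ (x * g * x⁻¹) u) ∂μ) ∧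
          Tendsto (fun n : ℕ => ∫ x in Ω n, B u' (ρ (x * g * x⁻¹) u) ∂μ) atTop (𝓝 (∫ x in Ω (R g), B u' (ρ (x * g * x⁻¹) u) ∂μ))) ∧
        (∀ g : (UnitaryGroup.cmDatum L 2 H).Local v, IsRegularElt ((e g : ↥(unitaryGroupOfForm (galAdicCompletionMap (L := L) (IsCMField.complexConj L) hw)
            ((StdForm.antidiagonal 2).over (w.1.adicCompletion L)))) : GL (Fin 2) (w.1.adicCompletion L)) →
          ¬ IsCompact ((Subgroup.centralizer ({g} : Set ((UnitaryGroup.cmDatum L 2 H).Local v))) : Set ((UnitaryGroup.cmDatum L 2 H).Local v)) →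
          ∃ (t y₀ : ↥(unitaryGroupOfForm (galAdicCompletionMap (L := L) (IsCMField.complexConj L) hw) ((StdForm.antidiagonal 2).over (w.1.adicCompletion L))))
            (d : Fin 2 → (w.1.adicCompletion L)ˣ) (lam mg : ℕ),
            glDiagonal 2 (w.1.adicCompletion L) d = (t : GL (Fin 2) (w.1.adicCompletion L)) ∧ IsRegularElt (t : GL (Fin 2) (w.1.adicCompletion L)) ∧
            (∀ i k : Fin 2, i ≠ k → Valued.v (ϖ ^ lam) ≤ Valued.v ((d i : w.1.adicCompletion L) - d k)) ∧
            (∀ lam' : ℕ, (∀ i k : Fin 2, i ≠ k → Valued.v (ϖ ^ lam') ≤ Valued.v ((d i : w.1.adicCompletion L) - d k)) → lam ≤ lam') ∧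
            e g ∈ ΩM mg ∧ (∀ m' : ℕ, e g ∈ ΩM m' → mg ≤ m') ∧
            y₀ ∈ ΩM (2 * mg + 2 * lam) ∧ e g = y₀ * t * y₀⁻¹ ∧
            R g = 5 * (2 * mθ + 2 * lam) + 3 * (2 * mg + 2 * lam) + 1) by
    obtain ⟨R, mθ, hθ, hae, hdat⟩ := key _ (K2E3TruncatedCharTransport.isSmooth_comp_continuousMulEquiv_symm e ρ hsm)
      (K2E3TruncatedCharTransport.isSupercuspidal_comp_continuousMulEquiv_symm e ρ hsc)
      (fun m x y => by rw [MonoidHom.comp_apply, MonoidHom.coe_coe]; exact hBinv _ x y)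
      (fun m' => by rw [MonoidHom.comp_apply, MonoidHom.coe_coe])
    exact ⟨Ω, R, mθ, hΩ, hθ, hae, hdat, hregae, htrans⟩
  intro ρM hsmM hscM hBinvM hρM
  -- the support height `m_θ` of `θ_M` (compact support: ★ `IsSupercuspidal.hasCompactSupport_sesqForm_apply_apply`, compact centre ★ [M2a] FILE A)
  have hZc := K2E3SupercuspModelFrameAtPlaceTwo.isCompact_center_of_eq_over L w hw (J := (StdForm.antidiagonal 2).over (w.1.adicCompletion L)) rfl
  have hcs : HasCompactSupport fun m' : ↥(unitaryGroupOfForm (galAdicCompletionMap (L := L) (IsCMField.complexConj L) hw) ((StdForm.antidiagonal 2).over (w.1.adicCompletion L))) =>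
      B u' (ρM m' u) := hscM.hasCompactSupport_sesqForm_apply_apply hZc hsmM hBinvM u u'
  obtain ⟨mθ, hmθ⟩ := ΩM.exists_superset_of_isCompact hcs.isCompact
  have hθ : ∀ m' : ↥(unitaryGroupOfForm (galAdicCompletionMap (L := L) (IsCMField.complexConj L) hw) ((StdForm.antidiagonal 2).over (w.1.adicCompletion L))),
      B u' (ρM m' u) ≠ 0 → m' ∈ ΩM mθ := fun m' h => hmθ (subset_tsupport _ (Function.mem_support.2 h))
  -- the radius, element by element on the model (§1), read at `e g`
  choose Rf hRf using fun m' => hRD (μ.map e) ρM hsmM hscM hBinvM hθ m'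
  refine ⟨fun g => Rf (e g), mθ, fun m' h => hθ m' (by rw [hρM]; exact h), ?_, fun g hreg hZ => ?_⟩
  · -- the two shapes, a.e.: shell vanishing at the regular `e g` (§1 (i)), ★ (f1) §4 on `M`, transport ★ [M5′] §2
    filter_upwards [hregae] with g hreg
    have h0 := (hRf (e g)).1 hreg
    have hφ : Continuous fun x : ↥(unitaryGroupOfForm (galAdicCompletionMap (L := L) (IsCMField.complexConj L) hw) ((StdForm.antidiagonal 2).over (w.1.adicCompletion L))) =>
        B u' (ρM (x * e g * x⁻¹) u) :=
      (((Representation.IsSmooth.isLocallyConstant_apply ρM hsmM u).comp fun z : V => B u' z).continuous).comp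
        ((continuous_id.mul continuous_const).mul continuous_inv)
    have hmeas : ∀ n : ℕ, MeasurableSet (ΩM n : Set ↥(unitaryGroupOfForm (galAdicCompletionMap (L := L) (IsCMField.complexConj L) hw)
        ((StdForm.antidiagonal 2).over (w.1.adicCompletion L)))) := fun n => (ΩM.isCompact n).measurableSet
    have hint : ∀ n : ℕ, IntegrableOn (fun x : ↥(unitaryGroupOfForm (galAdicCompletionMap (L := L) (IsCMField.complexConj L) hw)
        ((StdForm.antidiagonal 2).over (w.1.adicCompletion L))) => B u' (ρM (x * e g * x⁻¹) u)) (ΩM n) (μ.map e) :=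
      fun n => hφ.continuousOn.integrableOn_compact (ΩM.isCompact n)
    have hcanc := K2E3RightInvariantSetIntegralVanishing.setIntegral_eq_setIntegral_inter_of_sdiff_eq_zero (μ.map e) ΩM hmeas (Rf (e g)) _ hint h0
    have hlim := K2E3RightInvariantSetIntegralVanishing.tendsto_setIntegral_of_forall_sdiff_eq_zero (μ.map e) ΩM (fun _ _ h => ΩM.subset h) hmeas (Rf (e g)) _ hint h0
    have hT := K2E3TruncatedCharTransport.truncated_eq_inter_and_tendsto_of_map e μ (fun m' => B u' (ρM m' u)) ΩM Ω hΩ g hcanc hlim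
    have hρM' : ∀ z : (UnitaryGroup.cmDatum L 2 H).Local v, ρM (e z) = ρ z := fun z => by rw [hρM, ContinuousMulEquiv.symm_apply_apply]
    simp only [hρM'] at hT
    exact hT
  · -- the datum at `e g` (§1 (ii)); ellipticity transports along `e` (★ [M5′] §3)
    have hZM := mt (K2E3TruncatedCharTransport.isCompact_centralizer_iff_of_continuousMulEquiv e g).2 hZ
    exact (hRf (e g)).2 hreg hZM

set_option maxHeartbeats 800000 in
-- the statement is long (ten exported clauses on the CM ∕ one-place carriers); default budget runs out in its elaboration (same class as ★ [M2a] FILE B's 800000)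
/-- **[M6′] IN THE CONSUMERS' BINDERS, WITH THE EXPLICIT BALL AND THE `hball` REDUCTION.**  Along `e : G ≃ₜ* M` as above: a compact exhaustion `Ω` (`= e⁻¹ Ω_M`), a radius `R`, a support
height `m_θ`, `F g := Θ_{R g}(g)` and `Bset g := Ω (R g) = e⁻¹(Ω_M (R g))` (compact) such that `hlim` and `hcanc` of ★ p856184 ∕ ★ p856355 hold TOKEN FOR TOKEN (guard idle), the DATUM
clause of the MAIN theorem describes `R g` at every `g` with `e g` regular and `Z_G(g)` non-compact, `e g` is regular a.e., and the DOMINATION bricks reduce to MODEL inequalities: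
**`hball_of_model_bound`** — for every `W_M : M → ℝ`, if for a.e. `g` off the regular-elliptic set `∫_{Ω_M (R g)} ‖θ_M(x′ (e g) x′⁻¹)‖ d(e_* μ) ≤ W_M (e g)`, then `hball` holds for
`Bset` and `W := W_M ∘ e`; **`hballE_of_model_bound`** — likewise for the full integrals on the regular-elliptic set.  With ★ [M6] §4 (`sigSCan_datum_of_domination_bricks`'s shape)
this pins `Bset` for (SC-dom)₂ to ONE choice.  HYPOTHESIS-FIRST over the same single letter `hRD` (the [M6′]₂ FILE A head, ∀-closed).  The `Fin 2` twin of ★ [M6′]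
`K2E3SupercuspidalTruncatedCharLimCancExplicit.explicit_limit_localisation_and_hball_reduction`.
[cite: HarishChandra1970, Part VII §3 pp. 70–73; Thms 14, 18–20] [cite: Rogawski1990, §12.2 p. 173, §12.5 p. 182] [cite: Folland1995, §2.4] -/
theorem explicit_limit_localisation_and_hball_reduction
    {v : HeightOneSpectrum (𝓞 ↥(maximalRealSubfield L))} (w : PlacesOver L v) (hw : IsCMField.complexConj L • w.1 = w.1)
    [MeasurableSpace ((UnitaryGroup.cmDatum L 2 H).Local v)] [BorelSpace ((UnitaryGroup.cmDatum L 2 H).Local v)]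
    (μ : Measure ((UnitaryGroup.cmDatum L 2 H).Local v)) [μ.IsHaarMeasure]
    [MeasurableSpace ↥(unitaryGroupOfForm (galAdicCompletionMap (L := L) (IsCMField.complexConj L) hw) ((StdForm.antidiagonal 2).over (w.1.adicCompletion L)))]
    [BorelSpace ↥(unitaryGroupOfForm (galAdicCompletionMap (L := L) (IsCMField.complexConj L) hw) ((StdForm.antidiagonal 2).over (w.1.adicCompletion L)))]
    (e : (UnitaryGroup.cmDatum L 2 H).Local v ≃ₜ*
      ↥(unitaryGroupOfForm (galAdicCompletionMap (L := L) (IsCMField.complexConj L) hw) ((StdForm.antidiagonal 2).over (w.1.adicCompletion L))))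
    (ΩM : CompactExhaustion ↥(unitaryGroupOfForm (galAdicCompletionMap (L := L) (IsCMField.complexConj L) hw) ((StdForm.antidiagonal 2).over (w.1.adicCompletion L))))
    {ϖ : w.1.adicCompletion L}
    {V : Type*} [AddCommGroup V] [Module ℂ V] (ρ : Representation ℂ ((UnitaryGroup.cmDatum L 2 H).Local v) V) (hsm : ρ.IsSmooth) (hsc : ρ.IsSupercuspidal)
    (B : V →ₗ⋆[ℂ] V →ₗ[ℂ] ℂ) (hBinv : ∀ (g : (UnitaryGroup.cmDatum L 2 H).Local v) (x y : V), B (ρ g x) (ρ g y) = B x y) (u u' : V)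
    (hRD : ∀ (μM : Measure ↥(unitaryGroupOfForm (galAdicCompletionMap (L := L) (IsCMField.complexConj L) hw) ((StdForm.antidiagonal 2).over (w.1.adicCompletion L))))
      [μM.IsHaarMeasure]
      (ρM : Representation ℂ ↥(unitaryGroupOfForm (galAdicCompletionMap (L := L) (IsCMField.complexConj L) hw) ((StdForm.antidiagonal 2).over (w.1.adicCompletion L))) V),
      ρM.IsSmooth → ρM.IsSupercuspidal →
      (∀ (m : ↥(unitaryGroupOfForm (galAdicCompletionMap (L := L) (IsCMField.complexConj L) hw) ((StdForm.antidiagonal 2).over (w.1.adicCompletion L)))) (x y : V),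
        B (ρM m x) (ρM m y) = B x y) →
      ∀ {mθ : ℕ}, (∀ g : ↥(unitaryGroupOfForm (galAdicCompletionMap (L := L) (IsCMField.complexConj L) hw) ((StdForm.antidiagonal 2).over (w.1.adicCompletion L))),
        B u' (ρM g u) ≠ 0 → g ∈ ΩM mθ) →
      ∀ m : ↥(unitaryGroupOfForm (galAdicCompletionMap (L := L) (IsCMField.complexConj L) hw) ((StdForm.antidiagonal 2).over (w.1.adicCompletion L))),
      ∃ R : ℕ,
        (IsRegularElt (m : GL (Fin 2) (w.1.adicCompletion L)) → ∀ n : ℕ, ∫ x in ΩM n \ ΩM R, B u' (ρM (x * m * x⁻¹) u) ∂μM = 0) ∧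
        (IsRegularElt (m : GL (Fin 2) (w.1.adicCompletion L)) →
          ¬ IsCompact ((Subgroup.centralizer ({m} :
              Set ↥(unitaryGroupOfForm (galAdicCompletionMap (L := L) (IsCMField.complexConj L) hw) ((StdForm.antidiagonal 2).over (w.1.adicCompletion L)))) :
            Subgroup ↥(unitaryGroupOfForm (galAdicCompletionMap (L := L) (IsCMField.complexConj L) hw) ((StdForm.antidiagonal 2).over (w.1.adicCompletion L)))) :
              Set ↥(unitaryGroupOfForm (galAdicCompletionMap (L := L) (IsCMField.complexConj L) hw) ((StdForm.antidiagonal 2).over (w.1.adicCompletion L)))) →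
          ∃ (t y₀ : ↥(unitaryGroupOfForm (galAdicCompletionMap (L := L) (IsCMField.complexConj L) hw) ((StdForm.antidiagonal 2).over (w.1.adicCompletion L))))
            (d : Fin 2 → (w.1.adicCompletion L)ˣ) (lam mg : ℕ),
            glDiagonal 2 (w.1.adicCompletion L) d = (t : GL (Fin 2) (w.1.adicCompletion L)) ∧ IsRegularElt (t : GL (Fin 2) (w.1.adicCompletion L)) ∧
            (∀ i k : Fin 2, i ≠ k → Valued.v (ϖ ^ lam) ≤ Valued.v ((d i : w.1.adicCompletion L) - d k)) ∧
            (∀ lam' : ℕ, (∀ i k : Fin 2, i ≠ k → Valued.v (ϖ ^ lam') ≤ Valued.v ((d i : w.1.adicCompletion L) - d k)) → lam ≤ lam') ∧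
            m ∈ ΩM mg ∧ (∀ m' : ℕ, m ∈ ΩM m' → mg ≤ m') ∧
            y₀ ∈ ΩM (2 * mg + 2 * lam) ∧ m = y₀ * t * y₀⁻¹ ∧
            R = 5 * (2 * mθ + 2 * lam) + 3 * (2 * mg + 2 * lam) + 1)) :
    ∃ (Ω : CompactExhaustion ((UnitaryGroup.cmDatum L 2 H).Local v)) (R : (UnitaryGroup.cmDatum L 2 H).Local v → ℕ) (mθ : ℕ)
      (F : (UnitaryGroup.cmDatum L 2 H).Local v → ℂ) (Bset : (UnitaryGroup.cmDatum L 2 H).Local v → Set ((UnitaryGroup.cmDatum L 2 H).Local v)),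
      (∀ n : ℕ, (Ω n : Set ((UnitaryGroup.cmDatum L 2 H).Local v)) = e ⁻¹' (ΩM n)) ∧
      (∀ g, Bset g = e ⁻¹' (ΩM (R g))) ∧ (∀ g, IsCompact (Bset g)) ∧
      -- `hlim` of ★ p856184 and `hcanc` of ★ p856355, token for token
      (∀ᵐ g ∂μ, ¬ (IsRegularElt (g.val : GL (Fin 2) (UnitaryGroup.LocalRing L v)) ∧
          IsCompact ((Subgroup.centralizer ({g} : Set ((UnitaryGroup.cmDatum L 2 H).Local v))) : Set ((UnitaryGroup.cmDatum L 2 H).Local v))) →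
        Tendsto (fun n => ∫ x in Ω n, B u' (ρ (x * g * x⁻¹) u) ∂μ) atTop (𝓝 (F g))) ∧
      (∀ n : ℕ, ∀ᵐ g ∂μ, ¬ (IsRegularElt (g.val : GL (Fin 2) (UnitaryGroup.LocalRing L v)) ∧
          IsCompact ((Subgroup.centralizer ({g} : Set ((UnitaryGroup.cmDatum L 2 H).Local v))) : Set ((UnitaryGroup.cmDatum L 2 H).Local v))) →
        ∫ x in Ω n, B u' (ρ (x * g * x⁻¹) u) ∂μ = ∫ x in Ω n ∩ Bset g, B u' (ρ (x * g * x⁻¹) u) ∂μ) ∧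
      -- support height and the DATUM of the radius
      (∀ m' : ↥(unitaryGroupOfForm (galAdicCompletionMap (L := L) (IsCMField.complexConj L) hw) ((StdForm.antidiagonal 2).over (w.1.adicCompletion L))),
        B u' (ρ (e.symm m') u) ≠ 0 → m' ∈ ΩM mθ) ∧
      (∀ g : (UnitaryGroup.cmDatum L 2 H).Local v, IsRegularElt ((e g : ↥(unitaryGroupOfForm (galAdicCompletionMap (L := L) (IsCMField.complexConj L) hw)
          ((StdForm.antidiagonal 2).over (w.1.adicCompletion L)))) : GL (Fin 2) (w.1.adicCompletion L)) →
        ¬ IsCompact ((Subgroup.centralizer ({g} : Set ((UnitaryGroup.cmDatum L 2 H).Local v))) : Set ((UnitaryGroup.cmDatum L 2 H).Local v)) →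
        ∃ (t y₀ : ↥(unitaryGroupOfForm (galAdicCompletionMap (L := L) (IsCMField.complexConj L) hw) ((StdForm.antidiagonal 2).over (w.1.adicCompletion L))))
          (d : Fin 2 → (w.1.adicCompletion L)ˣ) (lam mg : ℕ),
          glDiagonal 2 (w.1.adicCompletion L) d = (t : GL (Fin 2) (w.1.adicCompletion L)) ∧ IsRegularElt (t : GL (Fin 2) (w.1.adicCompletion L)) ∧
          (∀ i k : Fin 2, i ≠ k → Valued.v (ϖ ^ lam) ≤ Valued.v ((d i : w.1.adicCompletion L) - d k)) ∧
          (∀ lam' : ℕ, (∀ i k : Fin 2, i ≠ k → Valued.v (ϖ ^ lam') ≤ Valued.v ((d i : w.1.adicCompletion L) - d k)) → lam ≤ lam') ∧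
          e g ∈ ΩM mg ∧ (∀ m' : ℕ, e g ∈ ΩM m' → mg ≤ m') ∧
          y₀ ∈ ΩM (2 * mg + 2 * lam) ∧ e g = y₀ * t * y₀⁻¹ ∧
          R g = 5 * (2 * mθ + 2 * lam) + 3 * (2 * mg + 2 * lam) + 1) ∧
      (∀ᵐ g ∂μ, IsRegularElt ((e g : ↥(unitaryGroupOfForm (galAdicCompletionMap (L := L) (IsCMField.complexConj L) hw)
          ((StdForm.antidiagonal 2).over (w.1.adicCompletion L)))) : GL (Fin 2) (w.1.adicCompletion L))) ∧
      -- `hball_of_model_bound` (★ p856355's `hball` for `W := W_M ∘ e`)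
      (∀ W_M : ↥(unitaryGroupOfForm (galAdicCompletionMap (L := L) (IsCMField.complexConj L) hw) ((StdForm.antidiagonal 2).over (w.1.adicCompletion L))) → ℝ,
        (∀ᵐ g ∂μ, ¬ (IsRegularElt (g.val : GL (Fin 2) (UnitaryGroup.LocalRing L v)) ∧
            IsCompact ((Subgroup.centralizer ({g} : Set ((UnitaryGroup.cmDatum L 2 H).Local v))) : Set ((UnitaryGroup.cmDatum L 2 H).Local v))) →
          ∫ x' in ΩM (R g), ‖B u' (ρ (e.symm (x' * e g * x'⁻¹)) u)‖ ∂(μ.map e) ≤ W_M (e g)) →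
        ∀ᵐ g ∂μ, ¬ (IsRegularElt (g.val : GL (Fin 2) (UnitaryGroup.LocalRing L v)) ∧
            IsCompact ((Subgroup.centralizer ({g} : Set ((UnitaryGroup.cmDatum L 2 H).Local v))) : Set ((UnitaryGroup.cmDatum L 2 H).Local v))) →
          ∫ x in Bset g, ‖B u' (ρ (x * g * x⁻¹) u)‖ ∂μ ≤ W_M (e g)) ∧
      -- `hballE_of_model_bound` (★ p856355's `hballE` for `W := W_M ∘ e`)
      (∀ W_M : ↥(unitaryGroupOfForm (galAdicCompletionMap (L := L) (IsCMField.complexConj L) hw) ((StdForm.antidiagonal 2).over (w.1.adicCompletion L))) → ℝ,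
        (∀ᵐ g ∂μ, (IsRegularElt (g.val : GL (Fin 2) (UnitaryGroup.LocalRing L v)) ∧
            IsCompact ((Subgroup.centralizer ({g} : Set ((UnitaryGroup.cmDatum L 2 H).Local v))) : Set ((UnitaryGroup.cmDatum L 2 H).Local v))) →
          ∫ x', ‖B u' (ρ (e.symm (x' * e g * x'⁻¹)) u)‖ ∂(μ.map e) ≤ W_M (e g)) →
        ∀ᵐ g ∂μ, (IsRegularElt (g.val : GL (Fin 2) (UnitaryGroup.LocalRing L v)) ∧
            IsCompact ((Subgroup.centralizer ({g} : Set ((UnitaryGroup.cmDatum L 2 H).Local v))) : Set ((UnitaryGroup.cmDatum L 2 H).Local v))) →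
          ∫ x, ‖B u' (ρ (x * g * x⁻¹) u)‖ ∂μ ≤ W_M (e g)) := by
  obtain ⟨Ω, R, mθ, hΩ, hθ, hae, hdat, hregae, htrans⟩ :=
    exists_explicit_exhaustion_radius L H w hw μ e ΩM ρ hsm hsc B hBinv u u' hRD
  have hBset : ∀ g, (Ω (R g) : Set ((UnitaryGroup.cmDatum L 2 H).Local v)) = e ⁻¹' (ΩM (R g)) := fun g => hΩ (R g)
  refine ⟨Ω, R, mθ, fun g => ∫ x in Ω (R g), B u' (ρ (x * g * x⁻¹) u) ∂μ, fun g => Ω (R g), hΩ, hBset, fun g => Ω.isCompact (R g), ?_, fun n => ?_, hθ, hdat,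
    hregae, fun W_M hWM => ?_, fun W_M hWM => ?_⟩
  · filter_upwards [hae] with g hg _
    exact hg.2
  · filter_upwards [hae] with g hg _
    exact hg.1 n
  · filter_upwards [hWM] with g hg hng
    rw [hBset g, htrans g]
    exact hg hng
  · filter_upwards [hWM] with g hg hell
    have h := htrans g Set.univ
    rw [Set.preimage_univ, Measure.restrict_univ, Measure.restrict_univ] at h
    rw [h]
    exact hg hell

end Carrier

end Summit.HodgeConjecture.HodgeConjecture.Cruxes.H413.K2E3SupercuspidalTruncatedCharLimCancExplicitTwo

end
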